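import Summits.ResolutionOfSingularities.ResolutionOfSingularities.Theorems.WeightedInvariantIota3SigmaIdealDescent
import Summits.ResolutionOfSingularities.ResolutionOfSingularities.Theorems.WeightedInvariantIota3SigmaGaloisDescent
import Summits.ResolutionOfSingularities.ResolutionOfSingularities.Theorems.WeightedInvariantIota3EpsEssSmooth
import HarnessLib

/-!
# GAP 2 (`jSigmaPt` commutes with 𝔪-preserving essentially smooth local maps at equal dimension three) ⟸ descent of the two levels of
# every upstairs σ-maximiser + ascent of (EX) — no canonicity needed (door `HypersurfaceCentreConstruction`, stmt-ResolutionOfSingularities-19897;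
# P3 rung `stub_keyRungGrHomLE_three`, gap GAP 2)

Topic: `Summits/ResolutionOfSingularities/ResolutionOfSingularities/Theorems`. Helper for the door item `HypersurfaceCentreConstruction`
(stmt-ResolutionOfSingularities-19897, route `WeightedInvariant`), line `local-engine` (skeleton v3.12 `7a4b52ef`), def-free.  Sequel of
`keyRungGrHomLE_three_of_idealDescent3` (…Iota3SigmaIdealDescent, p819841).  Its hypothesis GAP 2,
`jSigmaPt T' (φ g) m = (jSigmaPt T g m)·T'` for `φ : T → T'` local formally smooth e.f.t., `𝔪_T T' = 𝔪_{T'}`, `dim T = 3`, `ε(g) = 0`, is here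
derived from the SAME KIND of ideal-descent statement as (σ-ext)₃ — because `jSigmaPtLocal f m` is the CHOICE-FREE sup of the degree-`m`
pieces of ALL primitive σ-maximisers, no canonicity (J-can) is needed (contrast the Galois route …Iota3SigmaGaloisDescent §4):

* §1 (any flat algebra of local rings with `𝔪S' = 𝔪'`)
  - `isSigmaMaximiser_of_filtration_eq`: a two-flag of `S` whose image has the filtration of an upstairs σ-maximiser of `φ f` IS a
    σ-maximiser of `f` (same triple): reach by faithful flatness, maximality because reaches ascend;
  - `isSigmaMaximiser_algebraMap_of_maxDescent`: if every upstairs maximiser's triple is reached downstairs and SOME upstairs maximiser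
    exists, the image of a downstairs maximiser is an upstairs maximiser (`SigmaGaloisDescent.lexLE_trans`);
  - **`jSigmaPtLocal_map_eq_of_maxDescent`**: hence `jSigmaPtLocal (φ f) m = (jSigmaPtLocal f m)·S'` from (MAXF-desc) «every σ-maximiser of
    `φ f` has the filtration of the image of a two-flag of `S`» and (EX-asc) «a maximiser downstairs ⇒ a maximiser upstairs».
* §2 (dimension three, regular, `φ` formally smooth e.f.t.) (MAXF-desc) ⟸ «the two levels `F'(r₁)`, `F'(r₂)` of every upstairs σ-maximiser
  are extended from `T`» by the tree's «LEMMA R» `JFlatEssSmooth.exists_isTwoFlag_eq_of_extended`; so **`gap2_of_maxIdealDescent`**: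
  GAP 2 ⟸ (IDLmax-desc)₃ ∧ (EX-asc)₃.
* §3 **`keyRungGrHomLE_three_of_idealDescent3'`** — the gap list with SIX hypotheses, all σ/J-inputs now ideal-descent or existence
  statements: (desc-τ), (IDL-desc)₃ (levels of flags reaching a max-ratio triple with `q < r₂`), (IDLmax-desc)₃ (levels of σ-maximisers, at
  `ε = 0`), (EX-asc)₃, hgame, the residue of the dominance word at the power positions.

[OURS · L1 W4.3 · kernel lemmas + audit glue]  Replaces the role of NO printed item; NOT a statement of the manuscript
[claim: Hironaka2017, status: under-review]; candidates stay candidates; AI work, weaker than expert review.  No definition; no axiom.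

## References

* H. Hironaka, *Characteristic polyhedra of singularities*, J. Math. Kyoto Univ. 7 (1967), §3. [Hironaka1967]
* H. Matsumura, *Commutative Ring Theory* (1987), Thm. 7.5. [Matsumura1987]
-/

noncomputable section

set_option linter.dupNamespace false -- mandated namespace `Summit.<Summit>.<Problem>` of this single-conjunct summit

open IsLocalRing Literature.AlgebraicGeometry.Resolution
open Summit.ResolutionOfSingularities.ResolutionOfSingularities.Theorems

namespace Summit.ResolutionOfSingularities.ResolutionOfSingularities.Cruxes.HypersurfaceCentreConstruction.LocalEngine

namespace Iota3

/-! ## §1 `jSigmaPtLocal` commutes with flat 𝔪-preserving maps under maximiser descent -/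

section MaxDesc

variable {S S' : Type} [CommRing S] [CommRing S'] [IsLocalRing S] [IsLocalRing S'] [Algebra S S'] [Module.Flat S S']
  (hm : (maximalIdeal S).map (algebraMap S S') = maximalIdeal S')
include hm

/-- **A downstairs two-flag with the filtration of an upstairs σ-maximiser is a σ-maximiser downstairs** (same triple, same `ν`).
[OURS · L1 W4.3] -/
theorem isSigmaMaximiser_of_filtration_eq {f : S} {ν q r₁ r₂ : ℕ} {g₁' g₂' : S'}
    (hmax : IsSigmaMaximiser (algebraMap S S' f) ν g₁' g₂' q r₁ r₂) {g₁ g₂ : S} (hfl : IsTwoFlag g₁ g₂)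
    (heq : ∀ n, flagContactFiltration (algebraMap S S' g₁) (algebraMap S S' g₂) q r₁ r₂ n = flagContactFiltration g₁' g₂' q r₁ r₂ n) :
    IsSigmaMaximiser f ν g₁ g₂ q r₁ r₂ := by
  obtain ⟨hadm, -, hmem, hlex⟩ := hmax
  refine ⟨hadm, hfl, ?_, fun q' r₁' r₂' hadm' hreach => hlex q' r₁' r₂' hadm' (hreach.algebraMap_of_flat hm)⟩
  rw [mem_iff_algebraMap_mem_map_of_flat hm (flagContactFiltration g₁ g₂ q r₁ r₂ (r₁ * ν)) f,
    map_flagContactFiltration_eq (algebraMap S S') hm, heq]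
  exact hmem

/-- **The image of a downstairs σ-maximiser is an upstairs σ-maximiser**, provided every upstairs maximiser's triple is reached downstairs and
some upstairs maximiser exists (transitivity of the lexicographic comparison). [OURS · L1 W4.3] -/
theorem isSigmaMaximiser_algebraMap_of_maxDescent {f : S} {ν : ℕ}
    (hex : ∃ (h₁ h₂ : S') (Q R₁ R₂ : ℕ), IsSigmaMaximiser (algebraMap S S' f) ν h₁ h₂ Q R₁ R₂)
    (hdesc : ∀ (h₁ h₂ : S') (Q R₁ R₂ : ℕ), IsSigmaMaximiser (algebraMap S S' f) ν h₁ h₂ Q R₁ R₂ → FlagReaches f ν Q R₁ R₂)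
    {G₁ G₂ : S} {q r₁ r₂ : ℕ} (hG : IsSigmaMaximiser f ν G₁ G₂ q r₁ r₂) :
    IsSigmaMaximiser (algebraMap S S' f) ν (algebraMap S S' G₁) (algebraMap S S' G₂) q r₁ r₂ := by
  obtain ⟨hadm, hfl, hmem, hlex⟩ := hG
  refine ⟨hadm, hfl.algebraMap_of_flat hm, map_mem_flagContactFiltration (algebraMap S S') hm.le hmem,
    fun q' r₁' r₂' hadm' hreach => ?_⟩
  obtain ⟨h₁, h₂, Q, R₁, R₂, hH⟩ := hex
  have h12 := hH.2.2.2 q' r₁' r₂' hadm' hreach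
  have h23 := hlex Q R₁ R₂ hH.1 (hdesc h₁ h₂ Q R₁ R₂ hH)
  exact SigmaGaloisDescent.lexLE_trans hadm'.pos.2.2 hH.1.pos.1 hH.1.pos.2.2 hH.1.pos.2.1 hadm.pos.2.2 h12 h23

/-- **`jSigmaPtLocal` COMMUTES WITH `φ` UNDER MAXIMISER DESCENT**: `φ : S → S'` a flat algebra of local rings with `𝔪S' = 𝔪'`, `f ∈ 𝔪 ∖ 0`; if
(MAXF-desc) every σ-maximiser of `φ f` has the filtration of the image of a two-flag of `S`, and (EX-asc) a maximiser downstairs yields a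
maximiser upstairs, then `jSigmaPtLocal (φ f) m = (jSigmaPtLocal f m)·S'` for every `m` — NO canonicity (J-can) needed, since `jSigmaPtLocal`
is the choice-free sup over all primitive maximisers. [OURS · L1 W4.3 · GAP 2 mechanism] -/
theorem jSigmaPtLocal_map_eq_of_maxDescent {f : S} (hf0 : f ≠ 0) (hfu : ¬ IsUnit f)
    (hex : (∃ (G₁ G₂ : S) (q r₁ r₂ : ℕ), IsSigmaMaximiser f (adicOrder f).toNat G₁ G₂ q r₁ r₂) →
      ∃ (h₁ h₂ : S') (Q R₁ R₂ : ℕ), IsSigmaMaximiser (algebraMap S S' f) (adicOrder f).toNat h₁ h₂ Q R₁ R₂)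
    (hdesc : ∀ (g₁' g₂' : S') (q r₁ r₂ : ℕ), IsSigmaMaximiser (algebraMap S S' f) (adicOrder f).toNat g₁' g₂' q r₁ r₂ →
      ∃ g₁ g₂ : S, IsTwoFlag g₁ g₂ ∧
        ∀ n, flagContactFiltration (algebraMap S S' g₁) (algebraMap S S' g₂) q r₁ r₂ n = flagContactFiltration g₁' g₂' q r₁ r₂ n)
    (m : ℕ) : jSigmaPtLocal (algebraMap S S' f) m = (jSigmaPtLocal f m).map (algebraMap S S') := by
  haveI : IsLocalHom (algebraMap S S') := isLocalHom_of_map_maximalIdeal_eq hm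
  have hf0' : algebraMap S S' f ≠ 0 := fun h => hf0 (by
    have h1 := (mem_iff_algebraMap_mem_map_of_flat hm (⊥ : Ideal S) f).mpr (by rw [Ideal.map_bot, h]; exact Ideal.zero_mem _)
    exact (Submodule.mem_bot S).mp h1)
  have hfu' : ¬ IsUnit (algebraMap S S' f) := fun h => hfu ((isUnit_map_iff (algebraMap S S') f).mp h)
  have hν : (adicOrder (algebraMap S S' f)).toNat = (adicOrder f).toNat := by rw [adicOrder_algebraMap_eq_of_flat hm]
  have hreach : ∀ (h₁ h₂ : S') (Q R₁ R₂ : ℕ), IsSigmaMaximiser (algebraMap S S' f) (adicOrder f).toNat h₁ h₂ Q R₁ R₂ →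
      FlagReaches f (adicOrder f).toNat Q R₁ R₂ := fun h₁ h₂ Q R₁ R₂ hH => by
    obtain ⟨g₁, g₂, hfl, heq⟩ := hdesc h₁ h₂ Q R₁ R₂ hH
    exact (isSigmaMaximiser_of_filtration_eq hm hH hfl heq).flagReaches
  rw [jSigmaPtLocal_of_ne hf0' hfu', jSigmaPtLocal_of_ne hf0 hfu, hν]
  simp only [Ideal.map_iSup]
  refine le_antisymm ?_ ?_
  · refine iSup_le fun g₁' => iSup_le fun g₂' => iSup_le fun q => iSup_le fun r₁ => iSup_le fun r₂ => iSup_le fun h => ?_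
    obtain ⟨g₁, g₂, hfl, heq⟩ := hdesc g₁' g₂' q r₁ r₂ h.1
    have hmax' := isSigmaMaximiser_of_filtration_eq hm h.1 hfl heq
    refine le_iSup_of_le g₁ (le_iSup_of_le g₂ (le_iSup_of_le q (le_iSup_of_le r₁ (le_iSup_of_le r₂ (le_iSup_of_le ⟨hmax', h.2⟩ ?_)))))
    rw [map_flagContactFiltration_eq (algebraMap S S') hm, heq m]
  · refine iSup_le fun G₁ => iSup_le fun G₂ => iSup_le fun q => iSup_le fun r₁ => iSup_le fun r₂ => iSup_le fun h => ?_
    have hG' := isSigmaMaximiser_algebraMap_of_maxDescent hm (hex ⟨G₁, G₂, q, r₁, r₂, h.1⟩) hreach h.1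
    refine le_iSup_of_le (algebraMap S S' G₁) (le_iSup_of_le (algebraMap S S' G₂) (le_iSup_of_le q (le_iSup_of_le r₁
      (le_iSup_of_le r₂ (le_iSup_of_le ⟨hG', h.2⟩ ?_)))))
    rw [map_flagContactFiltration_eq (algebraMap S S') hm]

end MaxDesc

/-! ## §2 Dimension three: GAP 2 from the descent of the levels of σ-maximisers -/

section DimThree

variable {S S' : Type} [CommRing S] [CommRing S'] [IsRegularLocalRing S] [IsRegularLocalRing S'] [Algebra S S']
  [IsLocalHom (algebraMap S S')] [Algebra.FormallySmooth S S'] [Algebra.EssFiniteType S S']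

omit [IsLocalHom (algebraMap S S')] in
/-- **GAP 2 for one `g`** from (IDLmax-desc) «the two levels of every σ-maximiser of `φ g` are extended» and (EX-asc) «a maximiser of `g` yields a
maximiser of `φ g`» («LEMMA R» turns extended levels into a downstairs two-flag with the same filtration). [OURS · L1 W4.3 · GAP 2 ⟸ ideal descent] -/
theorem jSigmaPt_map_eq_of_maxIdealDescent (h𝔪 : (maximalIdeal S).map (algebraMap S S') = maximalIdeal S') (g : S)
    (hex : g ≠ 0 → g ∈ maximalIdeal S →
      (∃ (G₁ G₂ : S) (q r₁ r₂ : ℕ), IsSigmaMaximiser g (adicOrder g).toNat G₁ G₂ q r₁ r₂) →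
      ∃ (h₁ h₂ : S') (Q R₁ R₂ : ℕ), IsSigmaMaximiser (algebraMap S S' g) (adicOrder g).toNat h₁ h₂ Q R₁ R₂)
    (hidl : g ≠ 0 → g ∈ maximalIdeal S → ∀ (g₁' g₂' : S') (q r₁ r₂ : ℕ),
      IsSigmaMaximiser (algebraMap S S' g) (adicOrder g).toNat g₁' g₂' q r₁ r₂ →
      ∃ J₁ J₂ : Ideal S, J₁.map (algebraMap S S') = flagContactFiltration g₁' g₂' q r₁ r₂ r₁ ∧
        J₂.map (algebraMap S S') = flagContactFiltration g₁' g₂' q r₁ r₂ r₂)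
    (m : ℕ) : jSigmaPt S' (algebraMap S S' g) m = (jSigmaPt S g m).map (algebraMap S S') := by
  haveI : Module.Flat S S' := IotaOrderEssSmooth.flat_of_formallySmooth_of_essFiniteType S S'
  rw [jSigmaPt_eq, jSigmaPt_eq]
  by_cases hg0 : g = 0
  · subst hg0; rw [map_zero, jSigmaPtLocal_zero, jSigmaPtLocal_zero, Ideal.map_bot]
  by_cases hgu : IsUnit g
  · rw [jSigmaPtLocal_of_isUnit hgu, jSigmaPtLocal_of_isUnit (hgu.map _), Ideal.map_top]
  have hg : g ∈ maximalIdeal S := (IsLocalRing.mem_maximalIdeal g).mpr (mem_nonunits_iff.mpr hgu)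
  refine jSigmaPtLocal_map_eq_of_maxDescent h𝔪 hg0 hgu (hex hg0 hg) (fun g₁' g₂' q r₁ r₂ hmax => ?_) m
  obtain ⟨J₁, J₂, hJ₁, hJ₂⟩ := hidl hg0 hg g₁' g₂' q r₁ r₂ hmax
  obtain ⟨g₁, g₂, hfl, -, -, heq⟩ := JFlatEssSmooth.exists_isTwoFlag_eq_of_extended h𝔪 hmax.2.1 hmax.1 hJ₁ hJ₂
  exact ⟨g₁, g₂, hfl, heq⟩

end DimThree

/-- **GAP 2 ⟸ (IDLmax-desc)₃ ∧ (EX-asc)₃** in the binder shape of the gap lists (`ε = 0` guard carried, unused by the mechanism).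
[OURS · L1 W4.3 · audit glue] -/
theorem gap2_of_maxIdealDescent
    (hex : ∀ (T T' : Type) [CommRing T] [IsRegularLocalRing T] [CommRing T'] [IsRegularLocalRing T'] [Algebra T T']
      [IsLocalHom (algebraMap T T')] [Algebra.FormallySmooth T T'] [Algebra.EssFiniteType T T'] (g : T),
      ringKrullDim T = (3 : ℕ) → ringKrullDim T' = (3 : ℕ) → (maximalIdeal T).map (algebraMap T T') = maximalIdeal T' →
      g ≠ 0 → g ∈ maximalIdeal T → iotaEps T g = 0 →
      (∃ (G₁ G₂ : T) (q r₁ r₂ : ℕ), IsSigmaMaximiser g (adicOrder g).toNat G₁ G₂ q r₁ r₂) →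
      ∃ (h₁ h₂ : T') (Q R₁ R₂ : ℕ), IsSigmaMaximiser (algebraMap T T' g) (adicOrder g).toNat h₁ h₂ Q R₁ R₂)
    (hidl : ∀ (T T' : Type) [CommRing T] [IsRegularLocalRing T] [CommRing T'] [IsRegularLocalRing T'] [Algebra T T']
      [IsLocalHom (algebraMap T T')] [Algebra.FormallySmooth T T'] [Algebra.EssFiniteType T T'] (g : T),
      ringKrullDim T = (3 : ℕ) → ringKrullDim T' = (3 : ℕ) → (maximalIdeal T).map (algebraMap T T') = maximalIdeal T' →
      g ≠ 0 → g ∈ maximalIdeal T → iotaEps T g = 0 → ∀ (g₁' g₂' : T') (q r₁ r₂ : ℕ),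
      IsSigmaMaximiser (algebraMap T T' g) (adicOrder g).toNat g₁' g₂' q r₁ r₂ →
      ∃ J₁ J₂ : Ideal T, J₁.map (algebraMap T T') = flagContactFiltration g₁' g₂' q r₁ r₂ r₁ ∧
        J₂.map (algebraMap T T') = flagContactFiltration g₁' g₂' q r₁ r₂ r₂) :
    ∀ (T T' : Type) [CommRing T] [IsRegularLocalRing T] [CommRing T'] [IsRegularLocalRing T'] [Algebra T T']
      [IsLocalHom (algebraMap T T')] [Algebra.FormallySmooth T T'] [Algebra.EssFiniteType T T'] (g : T),
      ringKrullDim T' ≤ 3 → (maximalIdeal T).map (algebraMap T T') = maximalIdeal T' → ringKrullDim T = (3 : ℕ) →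
      iotaEps T g = 0 → ∀ m : ℕ, jSigmaPt T' (algebraMap T T' g) m = (jSigmaPt T g m).map (algebraMap T T') := by
  intro T T' _ _ _ _ _ _ _ _ g _ h𝔪 hdim hε m
  have hdim' : ringKrullDim T' = (3 : ℕ) := (ringKrullDim_eq_of_map_maximalIdeal_eq (S := T) (S' := T') h𝔪).symm.trans hdim
  exact jSigmaPt_map_eq_of_maxIdealDescent h𝔪 g (fun hg0 hg => hex T T' g hdim hdim' h𝔪 hg0 hg hε)
    (fun hg0 hg => hidl T T' g hdim hdim' h𝔪 hg0 hg hε) m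

end Iota3

/-! ## §3 The gap list -/

open Iota3 in
/-- **P3 RUNG FOR THE NAMED PAIR MODULO SIX HYPOTHESES, ALL σ/J-INPUTS AS IDEAL DESCENT OR EXISTENCE**: (desc-τ); (IDL-desc)₃ (levels of flags
reaching a max-ratio triple with `q < r₂`); (IDLmax-desc)₃ (levels of σ-maximisers, `ε = 0`); (EX-asc)₃ (a maximiser downstairs ⇒ one upstairs,
`ε = 0`); hgame; the residue of the dominance word at the power positions — all along 𝔪-preserving local formally smooth e.f.t. maps of regular
local rings of dimension three. [OURS · L1 W4.3 · audit glue] -/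
theorem keyRungGrHomLE_three_of_idealDescent3' (p : ℕ)
    (hD : ∀ (T T' : Type) [CommRing T] [IsRegularLocalRing T] [CommRing T'] [IsRegularLocalRing T'] [Algebra T T']
      [IsLocalHom (algebraMap T T')] [Algebra.FormallySmooth T T'] [Algebra.EssFiniteType T T'] (g : T),
      ringKrullDim T' ≤ 3 → IsTiePosition T' (algebraMap T T' g) → IsTiePosition T g)
    (hidl : ∀ (A A' : Type) [CommRing A] [IsRegularLocalRing A] [CommRing A'] [IsRegularLocalRing A'] [Algebra A A']
      [IsLocalHom (algebraMap A A')] [Algebra.FormallySmooth A A'] [Algebra.EssFiniteType A A'] (g : A),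
      ringKrullDim A = (3 : ℕ) → ringKrullDim A' = (3 : ℕ) → (maximalIdeal A).map (algebraMap A A') = maximalIdeal A' →
      g ≠ 0 → g ∈ maximalIdeal A → ∀ q r₁ r₂ : ℕ, AdmissibleTriple q r₁ r₂ → q < r₂ →
      ratioScale (adicOrder g).toNat * r₁ = sigmaRatioNat g * r₂ →
      ∀ g₁' g₂' : A', IsTwoFlag g₁' g₂' →
      algebraMap A A' g ∈ flagContactFiltration g₁' g₂' q r₁ r₂ (r₁ * (adicOrder g).toNat) →
      ∃ J₁ J₂ : Ideal A, J₁.map (algebraMap A A') = flagContactFiltration g₁' g₂' q r₁ r₂ r₁ ∧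
        J₂.map (algebraMap A A') = flagContactFiltration g₁' g₂' q r₁ r₂ r₂)
    (hidlmax : ∀ (T T' : Type) [CommRing T] [IsRegularLocalRing T] [CommRing T'] [IsRegularLocalRing T'] [Algebra T T']
      [IsLocalHom (algebraMap T T')] [Algebra.FormallySmooth T T'] [Algebra.EssFiniteType T T'] (g : T),
      ringKrullDim T = (3 : ℕ) → ringKrullDim T' = (3 : ℕ) → (maximalIdeal T).map (algebraMap T T') = maximalIdeal T' →
      g ≠ 0 → g ∈ maximalIdeal T → iotaEps T g = 0 → ∀ (g₁' g₂' : T') (q r₁ r₂ : ℕ),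
      IsSigmaMaximiser (algebraMap T T' g) (adicOrder g).toNat g₁' g₂' q r₁ r₂ →
      ∃ J₁ J₂ : Ideal T, J₁.map (algebraMap T T') = flagContactFiltration g₁' g₂' q r₁ r₂ r₁ ∧
        J₂.map (algebraMap T T') = flagContactFiltration g₁' g₂' q r₁ r₂ r₂)
    (hexasc : ∀ (T T' : Type) [CommRing T] [IsRegularLocalRing T] [CommRing T'] [IsRegularLocalRing T'] [Algebra T T']
      [IsLocalHom (algebraMap T T')] [Algebra.FormallySmooth T T'] [Algebra.EssFiniteType T T'] (g : T),
      ringKrullDim T = (3 : ℕ) → ringKrullDim T' = (3 : ℕ) → (maximalIdeal T).map (algebraMap T T') = maximalIdeal T' →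
      g ≠ 0 → g ∈ maximalIdeal T → iotaEps T g = 0 →
      (∃ (G₁ G₂ : T) (q r₁ r₂ : ℕ), IsSigmaMaximiser g (adicOrder g).toNat G₁ G₂ q r₁ r₂) →
      ∃ (h₁ h₂ : T') (Q R₁ R₂ : ℕ), IsSigmaMaximiser (algebraMap T T' g) (adicOrder g).toNat h₁ h₂ Q R₁ R₂)
    (hgame : CanonicalGameClauseHomLE 3 p iotaFlatT jFlatT)
    (hres : ∀ (k₀ : Type) [Field k₀] [CharP k₀ p] [PerfectField k₀]
      (S : Type) [CommRing S] [Algebra k₀ S] [Algebra.EssFiniteType k₀ S] [IsRegularLocalRing S] (f : S),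
      ringKrullDim S = (3 : ℕ) → f ≠ 0 → f ∈ (maximalIdeal S) ^ 2 →
      ContactCylinder.topStratumPrime iotaOrdEpsTau S f = maximalIdeal S → iotaEps S f ≠ 1 →
      (∃ ℓ ∈ maximalIdeal S, f ∈ Ideal.span {ℓ ^ (adicOrder f).toNat} ⊔ maximalIdeal S ^ ((adicOrder f).toNat + 1)) →
      ∀ (a b : ℕ), 0 < b →
      (∀ q' r₁' r₂' : ℕ, AdmissibleTriple q' r₁' r₂' → FlagReaches f (adicOrder f).toNat q' r₁' r₂' → r₁' * b ≤ a * r₂') →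
      ∀ (g₁ g₂ g₁' g₂' : S) (q r₁ r₂ : ℕ), AdmissibleTriple q r₁ r₂ → r₁ * b = a * r₂ → q < r₂ → r₂ < r₁ →
        IsTwoFlag g₁ g₂ → IsTwoFlag g₁' g₂' →
        f ∈ flagContactFiltration g₁ g₂ q r₁ r₂ (r₁ * (adicOrder f).toNat) →
        f ∈ flagContactFiltration g₁' g₂' q r₁ r₂ (r₁ * (adicOrder f).toNat) →
        g₂' ∈ flagContactFiltration g₁ g₂ q r₁ r₂ r₂) :
    KeyRungGrHomLE 3 p :=
  keyRungGrHomLE_three_of_idealDescent3 p hD hidl (gap2_of_maxIdealDescent hexasc hidlmax) hgame hres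

end Summit.ResolutionOfSingularities.ResolutionOfSingularities.Cruxes.HypersurfaceCentreConstruction.LocalEngine

end
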